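import Summits.BirchSwinnertonDyer.BirchSwinnertonDyer.Theorems.ManinLocalTwoThreeShiftClassGenerationThreeHolds
import Summits.BirchSwinnertonDyer.BirchSwinnertonDyer.Theorems.ManinLocalTwoThreeManinPrimeToThreeAtNineKatoShiftLever
import HarnessLib

/-!
# The POINTWISE Kato shift lever at `p = 3`, and the line `bed_at_three`'s Manin input from the CM-inert INSTANCES of F-es-18

Summit `BirchSwinnertonDyer`, crux `InertBadAtThree` (stmt-BirchSwinnertonDyer-19225; K8 `InertBadSignedBranches` r4, shared
verbatim with BED `BiquadraticEisensteinDescent` r5), line of record `Lines/bed_at_three.lean` (lead `bsd-line-ibd-p1`), helper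
for the reshape v5 → v6 of its Manin stub (crux idea card `Cruxes/InertBadAtThree/Ideas/rubin-e1-inert-three.md`, bsd-idea-18 g6:
the line consumes the named Literature statement F-es-18
`Literature.NumberTheory.EllipticCurves.kato_neron_isIntegral_twistedSymbolSum_of_additive_three_polar` only POINTWISE, at the
CM curve in hand).

Route `ManinLocalTwoThree`'s lever `Theorems.ManinLocalTwoThree.katoShiftTwistManinThree_of_katoFact : F-es-18 →
KatoShiftTwistManinThree` (cell `pub/bsd-f2-manin`) applies the GLOBAL fact exactly once, at `V = W`
(`…KatoShiftLever.pint_charSum_div_three'`). This file re-runs that proof with the global fact replaced by a hypothesis on the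
curve `W` alone — in fact by the handful of ODD-character instances the argument uses — and obtains, UNCONDITIONALLY:

* `pint_charSum_div_three_of_oddInstance` — `(Σ_a χ(a) y(a))/3` is `3`-integral (up to a `3`-unit) for ONE odd `χ` mod an
  admissible `ℓ` with `χ(3) ≠ 1`, granted the F-es-18 instance for `(W, D.f, ℓ, χ)` only;
* `three_dvd_latticeCoord_shift_of_oddInstances`, `exists_int_im_shiftClass_eq_three_mul_of_oddInstances` — the shift
  congruence `3 ∣ y(3x) − y(x)` / `Im {a/ℓ, 3a/ℓ}_f ∈ 3ℤ·(Ω⁻_f/2)` from the instances at all odd `χ` mod `ℓ` with `χ(3) ≠ 1`;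
* **`not_three_dvd_c_of_neronIntegralAt`** — THE POINTWISE LEVER: at a lattice-optimal `X₀(N)`-datum of a globally minimal `W`
  with `9 ∣ N` and `W[3]` irreducible, the F-es-18 instances AT `W` give `3 ∤ c` (generation input = tree theorem
  `shiftClassGenerationThree_holds`, E-es-19; lattice-unit punchline `functional_nonvanishing_gen`);
* (companion file `…InertBadAtThreeManinOfNeronIntegralCMInert`: the line's Manin-at-3 statements from the F-es-18 body on
  the CM-INERT BAD-3 CLASS only — the v6 stub — and F-es-18 ⟹ those instances.)

HONEST FRAMING: nothing here proves F-es-18, any instance of it, Manin's conjecture, the crux, or BSD. The gain is logical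
placement: the line's Manin debt at `3` is the `3`-integrality (in Néron units) of finitely many types of twisted `L`-values of
CM curves with `3` inert in the CM field — an abelian statement (Hecke characters of a class-number-one field) with a second,
CM-side road (Eisenstein–Kronecker numbers; the card) — instead of Kato's explicit reciprocity law for every additive-at-3 curve.
No definitions; axioms standard.
-/

set_option autoImplicit false
set_option linter.dupNamespace false

noncomputable section

open scoped Classical MatrixGroups ModularForm

open CongruenceSubgroup Complex IsDedekindDomain Rat.HeightOneSpectrum NumberField WeierstrassCurve
  Literature.NumberTheory.EllipticCurves Literature.NumberTheory.EllipticCurves.ModularForms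
  Literature.NumberTheory.EllipticCurves.Rank1Residual
  Summit.BirchSwinnertonDyer.BirchSwinnertonDyer.Theorems.ManinFrameResidueProperRTameTwist
  Summit.BirchSwinnertonDyer.Rank1Residual.ManinAdditive
  Summit.BirchSwinnertonDyer.BirchSwinnertonDyer.Theorems.ManinLocalTwoThree

namespace Summit.BirchSwinnertonDyer.BirchSwinnertonDyer.Theorems.InertBadSignedBranchesInertBadAtThreePointwiseKatoLever

section Lever

variable {W : WeierstrassCurve ℚ} [W.IsElliptic] {N : ℕ} [NeZero N]

/-- **One odd character with `χ(3) ≠ 1`: `(Σ_a χ(a) y(a))/3` is `3`-integral (times a `3`-unit)**, granted ONLY the F-es-18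
instance for the curve `W`, its newform `D.f`, the modulus `ℓ` and the character `χ` (odd branch, all `ϖ`, `r`), at a
lattice-optimal datum with `3 ∣ c`, `9 ∣ N`, for an admissible `ℓ` (`ℓ ∤ N` prime, `ℓ ≡ 11 (mod 12)`, Legendre conditions at the
`q ∥ N`). Proof = `…KatoShiftLever.pint_charSum_div_three'` verbatim with the global fact's application replaced by `hKχ`.
[cite: Kato2004Asterisque, Thm. 9.7 (p. 189)] [cite: KostersPannekoek2017, Thm. 1 (ii)] -/
theorem pint_charSum_div_three_of_oddInstance
    (D : ModularParametrizationData W N)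
    (hopt : ∀ z ∈ D.L.lattice, ∃ w ∈ periodLattice D.f, z = D.c * w)
    (h3c : (3 : ℤ) ∣ D.c) (h9 : 3 ^ 2 ∣ N)
    {ℓ : ℕ} (hℓ : ℓ.Prime) (hℓN : ¬ ℓ ∣ N) (h12 : ℓ % 12 = 11)
    (hL : ∀ q ∈ N.primeFactors, ¬ q ^ 2 ∣ N →
      jacobiSym (q : ℤ) ℓ = (if ((q : ℤ) * W.LFunction q) % 3 = 1 then -1 else 1))
    {y : ZMod ℓ → ℤ}
    (hy : ∀ x : ZMod ℓ, (modularSymbol D.f (((x.val : ℕ) : ℚ) / ℓ) - modularSymbol D.f 0).im =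
      y x * (minusPeriod D.f / 2))
    (χ : DirichletCharacter ℂ ℓ) (hχ : χ.Odd)
    (hKχ : haveI : NeZero ℓ := ⟨hℓ.ne_zero⟩
      ∀ (ϖ : ℚ) (r : ℂ), (ϖ : ℝ) * W.imaginaryPeriodRat = minusPeriod D.f →
        (∏ q ∈ N.primeFactors with ¬ q ^ 2 ∣ N,
            (((q : ℂ) - (W.LFunction q : ℂ) * χ (q : ZMod ℓ)) *
              ((q : ℂ) - (W.LFunction q : ℂ) * (χ (q : ZMod ℓ))⁻¹))) *
            twistedSymbolSum D.f χ = r * (minusPeriod D.f : ℂ) * Complex.I →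
        ∃ s : ℕ, ¬ 3 ∣ s ∧ IsIntegral ℤ ((s : ℂ) * ϖ * r)) :
    haveI : NeZero ℓ := ⟨hℓ.ne_zero⟩
    ∃ s : ℕ, ¬ 3 ∣ s ∧ IsIntegral ℤ ((s : ℂ) * ((∑ a : ZMod ℓ, χ a * (y a : ℂ)) / (3 : ℕ))) := by
  haveI : NeZero ℓ := ⟨hℓ.ne_zero⟩
  haveI : Fact ℓ.Prime := ⟨hℓ⟩
  have hreal : ∀ n, (cuspCoeff D.f n).im = 0 :=
    cuspCoeff_im_eq_zero_of_coeffField_eq_bot D.isNewformOf.coeffField_eq_bot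
  have hΩf : 0 < minusPeriod D.f :=
    IsNewform0.minusPeriod_pos_holds D.isNewformOf.1 D.isNewformOf.coeffField_eq_bot
  have hc0 : D.c ≠ 0 := D.maninConstant_ne_zero_holds
  -- the period scalar `ϖ = m₀/|c|`
  obtain ⟨mm, hmm2, hmm⟩ := SkinnerUrban2014.exists_dvd_two_mul_imaginaryPeriodRat_eq_of_latticeEq D hopt
  set cabs : ℤ := |D.c| with hcabs
  have hcabs0 : cabs ≠ 0 := abs_ne_zero.mpr hc0
  set ϖ : ℚ := (mm : ℚ) / (cabs : ℚ) with hϖdef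
  have hcabsR : ((cabs : ℤ) : ℝ) = |(D.c : ℝ)| := by rw [hcabs, Int.cast_abs]
  have hϖ : (ϖ : ℝ) * W.imaginaryPeriodRat = minusPeriod D.f := by
    rw [hϖdef]; push_cast
    rw [hcabsR, div_mul_eq_mul_div, hmm]
    have habs0 : |(D.c : ℝ)| ≠ 0 := abs_ne_zero.mpr (by exact_mod_cast hc0)
    field_simp
  -- the symmetrised Euler factor and the twisted value
  set A : ℂ := ∑ a : ZMod ℓ, χ a * (y a : ℂ) with hAdef
  set E : ℂ := ∏ q ∈ N.primeFactors with ¬ q ^ 2 ∣ N,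
      (((q : ℂ) - (W.LFunction q : ℂ) * χ (q : ZMod ℓ)) *
        ((q : ℂ) - (W.LFunction q : ℂ) * (χ (q : ZMod ℓ))⁻¹)) with hEdef
  set T : ℂ := twistedSymbolSum D.f χ with hTdef
  have hT : T = I * (((minusPeriod D.f / 2 : ℝ) : ℂ) * A) := by
    have hpt : ∀ x : ZMod ℓ, χ x *
        (((modularSymbol D.f (((x.val : ℕ) : ℚ) / ℓ) - modularSymbol D.f 0).im : ℝ) : ℂ) =
        ((minusPeriod D.f / 2 : ℝ) : ℂ) * (χ x * (y x : ℂ)) := by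
      intro x; rw [hy x]; push_cast; ring
    rw [hTdef, twistedSymbolSum_eq_I_mul_sum D.f hℓ.ne_zero hreal χ hχ,
      Finset.sum_congr rfl (fun x _ ↦ hpt x), ← Finset.mul_sum]
  set r : ℂ := E * T / (((minusPeriod D.f : ℝ) : ℂ) * I) with hrdef
  have hden : ((minusPeriod D.f : ℝ) : ℂ) * I ≠ 0 :=
    mul_ne_zero (by exact_mod_cast hΩf.ne') I_ne_zero
  have hval : E * T = r * (minusPeriod D.f : ℂ) * Complex.I := by
    rw [hrdef, mul_assoc, div_mul_cancel₀ _ hden]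
  -- the instance
  obtain ⟨s, hs, hint⟩ := hKχ ϖ r hϖ hval
  -- `ϖ r = (m₀/(2|c|)) · E · A`
  have hcabsC : ((cabs : ℤ) : ℂ) ≠ 0 := by exact_mod_cast hcabs0
  have hϖC : (ϖ : ℂ) = (mm : ℂ) / ((cabs : ℤ) : ℂ) := by rw [hϖdef]; push_cast; rfl
  have hϖr : (ϖ : ℂ) * r = ((mm : ℂ) / (2 * ((cabs : ℤ) : ℂ))) * (E * A) := by
    rw [hrdef, hT, hϖC]
    have hΩ0 : ((minusPeriod D.f : ℝ) : ℂ) ≠ 0 := by exact_mod_cast hΩf.ne'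
    have h2 : ((minusPeriod D.f / 2 : ℝ) : ℂ) = ((minusPeriod D.f : ℝ) : ℂ) / 2 := by push_cast; rfl
    rw [h2]
    field_simp
  -- `|c| = 3 |c'|`
  obtain ⟨c', hc'⟩ := h3c
  have habs : cabs = 3 * |c'| := by
    rw [hcabs, hc', abs_mul]; norm_num
  have hc'0 : c' ≠ 0 := by rintro rfl; exact hc0 (by rw [hc', mul_zero])
  -- `s m₀ · E · (A/3)` is integral: multiply `s ϖ r` by `2|c'| ∈ ℤ`
  have hkey : (((2 * |c'| : ℤ)) : ℂ) * ((s : ℂ) * (ϖ : ℂ) * r) =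
      ((s * mm : ℕ) : ℂ) * (E * (A / (3 : ℕ))) := by
    rw [mul_assoc (s : ℂ), hϖr, habs]
    have habs' : ((|c'| : ℤ) : ℂ) ≠ 0 := by exact_mod_cast (abs_ne_zero.mpr hc'0)
    push_cast
    field_simp
  have hint2 : IsIntegral ℤ (((s * mm : ℕ) : ℂ) * (E * (A / (3 : ℕ)))) := by
    rw [← hkey]
    exact (isIntegral_algebraMap (R := ℤ) (x := (2 * |c'| : ℤ))).mul (by simpa [mul_assoc] using hint)
  have hsmm : ¬ 3 ∣ s * mm := by
    intro h
    rcases (Nat.Prime.dvd_mul Nat.prime_three).mp h with h1 | h2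
    · exact hs h1
    · have : mm ≤ 2 := Nat.le_of_dvd two_pos hmm2
      interval_cases mm <;> omega
  have hpintEA : ∃ s : ℕ, ¬ 3 ∣ s ∧ IsIntegral ℤ ((s : ℂ) * (E * (A / (3 : ℕ)))) := ⟨s * mm, hsmm, hint2⟩
  -- cancel the `3`-unit `E`
  have hℓN' : ¬ ℓ ∣ N := hℓN
  have h3q : ∀ q ∈ N.primeFactors, ¬ q ^ 2 ∣ N → q ≠ 3 := by
    rintro q hq hq2 rfl; exact hq2 h9
  have hLsq : ∀ q ∈ N.primeFactors, ¬ q ^ 2 ∣ N →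
      ((3 : ℤ) ∣ (q : ℤ) * W.LFunction q - 1 → ¬ IsSquare ((q : ℕ) : ZMod ℓ)) ∧
        (¬ (3 : ℤ) ∣ (q : ℤ) * W.LFunction q - 1 → IsSquare ((q : ℕ) : ZMod ℓ)) := by
    intro q hq hq2
    have hqp : q.Prime := Nat.prime_of_mem_primeFactors hq
    have hqℓ : q ≠ ℓ := by rintro rfl; exact hℓN (Nat.dvd_of_mem_primeFactors hq)
    exact legendre_condition_of_jacobiSym hℓ hqp hqℓ _ (hL q hq hq2)
  have ha : ∀ q ∈ N.primeFactors, ¬ q ^ 2 ∣ N →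
      W.LFunction q = 1 ∨ W.LFunction q = -1 ∨ W.LFunction q = 0 := fun q hq _ ↦
    lFunction_eq_one_or_neg_one_or_zero_of_dvd_level D.isNewformOf (Nat.prime_of_mem_primeFactors hq)
      (Nat.dvd_of_mem_primeFactors hq)
  obtain ⟨w, t, hw, hEw, ht⟩ := exists_symmEuler_prod_mul_eq_three' (ℓ := ℓ) h12 (N := N)
    (fun q ↦ W.LFunction q) ha h3q hℓN' hχ hLsq
  have ht' : ¬ ((3 : ℕ) : ℤ) ∣ t := ht
  exact pint_of_pint_mul_of_mul_eq Nat.prime_three hw hEw ht' hpintEA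

/-- **The shift congruence in lattice coordinates from the odd instances at `ℓ`**: `3 ∣ y(3x) − y(x)` for every unit `x`
mod `ℓ`, granted the F-es-18 instances at `W` for all odd `χ` mod `ℓ` with `χ(3) ≠ 1` (hole orthogonality `dvd_sub_of_hole`
at `u = 3`; `3 ∤ ℓ − 1`). [cite: Kato2004Asterisque, Thm. 9.7 (p. 189)] -/
theorem three_dvd_latticeCoord_shift_of_oddInstances
    (D : ModularParametrizationData W N)
    (hopt : ∀ z ∈ D.L.lattice, ∃ w ∈ periodLattice D.f, z = D.c * w)
    (h3c : (3 : ℤ) ∣ D.c) (h9 : 3 ^ 2 ∣ N)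
    {ℓ : ℕ} (hℓ : ℓ.Prime) (hℓN : ¬ ℓ ∣ N) (h12 : ℓ % 12 = 11)
    (hL : ∀ q ∈ N.primeFactors, ¬ q ^ 2 ∣ N →
      jacobiSym (q : ℤ) ℓ = (if ((q : ℤ) * W.LFunction q) % 3 = 1 then -1 else 1))
    {y : ZMod ℓ → ℤ}
    (hy : ∀ x : ZMod ℓ, (modularSymbol D.f (((x.val : ℕ) : ℚ) / ℓ) - modularSymbol D.f 0).im =
      y x * (minusPeriod D.f / 2))
    (hodd : ∀ x : ZMod ℓ, y (-x) = -y x)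
    (hKℓ : haveI : NeZero ℓ := ⟨hℓ.ne_zero⟩
      ∀ χ : DirichletCharacter ℂ ℓ, χ.Odd → χ (3 : ZMod ℓ) ≠ 1 →
        ∀ (ϖ : ℚ) (r : ℂ), (ϖ : ℝ) * W.imaginaryPeriodRat = minusPeriod D.f →
          (∏ q ∈ N.primeFactors with ¬ q ^ 2 ∣ N,
              (((q : ℂ) - (W.LFunction q : ℂ) * χ (q : ZMod ℓ)) *
                ((q : ℂ) - (W.LFunction q : ℂ) * (χ (q : ZMod ℓ))⁻¹))) *
              twistedSymbolSum D.f χ = r * (minusPeriod D.f : ℂ) * Complex.I →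
          ∃ s : ℕ, ¬ 3 ∣ s ∧ IsIntegral ℤ ((s : ℂ) * ϖ * r))
    (β : (ZMod ℓ)ˣ) :
    (3 : ℤ) ∣ y (3 * (β : ZMod ℓ)) - y β := by
  haveI : NeZero ℓ := ⟨hℓ.ne_zero⟩
  haveI : Fact ℓ.Prime := ⟨hℓ⟩
  obtain ⟨-, -, h3ℓ1, -, hℓ3, -⟩ := mod_twelve_facts (ℓ := ℓ) h12
  have hcop : Nat.Coprime 3 ℓ := (Nat.coprime_primes Nat.prime_three hℓ).mpr hℓ3.symm
  set u : (ZMod ℓ)ˣ := ZMod.unitOfCoprime 3 hcop with hu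
  have hu3 : (u : ZMod ℓ) = 3 := by rw [hu, ZMod.coe_unitOfCoprime]; norm_num
  have hφ : ¬ 3 ∣ ℓ.totient := by rw [Nat.totient_prime hℓ]; exact h3ℓ1
  have hf : ¬ 3 ∣ orderOf u := by
    intro h
    apply hφ
    rw [← ZMod.card_units_eq_totient ℓ]
    exact h.trans (orderOf_dvd_card)
  have hA : ∀ χ : DirichletCharacter ℂ ℓ, χ.Odd → χ (u : ZMod ℓ) ≠ 1 →
      ∃ s : ℕ, ¬ 3 ∣ s ∧ IsIntegral ℤ ((s : ℂ) * ((∑ a : ZMod ℓ, χ a * (y a : ℂ)) / (3 : ℕ))) := by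
    intro χ hχ hχu
    rw [hu3] at hχu
    exact pint_charSum_div_three_of_oddInstance D hopt h3c h9 hℓ hℓN h12 hL hy χ hχ (hKℓ χ hχ hχu)
  have h := dvd_sub_of_hole (p := 3) Nat.prime_three y hodd u β hφ hf hA
  rwa [Units.val_mul, hu3] at h

/-- **The shift class has imaginary part in `3ℤ·(Ω⁻_f/2)` from the odd instances at `ℓ`** (conclusion form of the hole step,
for `0 < a < ℓ`). [cite: Kato2004Asterisque, Thm. 9.7 (p. 189)] [cite: MazurTateTeitelbaum1986, §I.8] -/
theorem exists_int_im_shiftClass_eq_three_mul_of_oddInstances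
    (D : ModularParametrizationData W N)
    (hopt : ∀ z ∈ D.L.lattice, ∃ w ∈ periodLattice D.f, z = D.c * w) (h9 : 3 ^ 2 ∣ N)
    (h3c : (3 : ℤ) ∣ D.c)
    {ℓ : ℕ} (hℓ : ℓ.Prime) (hℓN : ¬ ℓ ∣ N) (h12 : ℓ % 12 = 11)
    (hL : ∀ q ∈ N.primeFactors, ¬ q ^ 2 ∣ N →
      jacobiSym (q : ℤ) ℓ = (if ((q : ℤ) * W.LFunction q) % 3 = 1 then -1 else 1))
    (hKℓ : haveI : NeZero ℓ := ⟨hℓ.ne_zero⟩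
      ∀ χ : DirichletCharacter ℂ ℓ, χ.Odd → χ (3 : ZMod ℓ) ≠ 1 →
        ∀ (ϖ : ℚ) (r : ℂ), (ϖ : ℝ) * W.imaginaryPeriodRat = minusPeriod D.f →
          (∏ q ∈ N.primeFactors with ¬ q ^ 2 ∣ N,
              (((q : ℂ) - (W.LFunction q : ℂ) * χ (q : ZMod ℓ)) *
                ((q : ℂ) - (W.LFunction q : ℂ) * (χ (q : ZMod ℓ))⁻¹))) *
              twistedSymbolSum D.f χ = r * (minusPeriod D.f : ℂ) * Complex.I →
          ∃ s : ℕ, ¬ 3 ∣ s ∧ IsIntegral ℤ ((s : ℂ) * ϖ * r))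
    (a : ℕ) (ha0 : 0 < a) (haℓ : a < ℓ) :
    ∃ n : ℤ, (shiftClass D.f ℓ a).im = 3 * n * (minusPeriod D.f / 2) := by
  haveI : NeZero ℓ := ⟨hℓ.ne_zero⟩
  haveI : Fact ℓ.Prime := ⟨hℓ⟩
  obtain ⟨y, hy, hodd⟩ := exists_latticeCoord D hℓ hℓN
  have hcop : Nat.Coprime a ℓ :=
    Nat.Coprime.symm ((Nat.Prime.coprime_iff_not_dvd hℓ).mpr (Nat.not_dvd_of_pos_of_lt ha0 haℓ))
  set β : (ZMod ℓ)ˣ := ZMod.unitOfCoprime a hcop with hβ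
  have hβa : (β : ZMod ℓ) = (a : ZMod ℓ) := by rw [hβ, ZMod.coe_unitOfCoprime]
  obtain ⟨n, hn⟩ :=
    three_dvd_latticeCoord_shift_of_oddInstances D hopt h3c h9 hℓ hℓN h12 hL hy hodd hKℓ β
  refine ⟨n, ?_⟩
  have h3a : modularSymbol D.f (((3 * a : ℕ) : ℚ) / ℓ) =
      modularSymbol D.f (((((3 * a : ℕ) : ZMod ℓ).val : ℕ) : ℚ) / ℓ) := by
    have := modularSymbol_div_eq_of_intCast D.f hℓ.ne_zero ((3 * a : ℕ) : ℤ)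
    rw [Int.cast_natCast] at this
    rw [this]; push_cast; ring_nf
  have h1a : modularSymbol D.f ((a : ℚ) / ℓ) =
      modularSymbol D.f (((((a : ℕ) : ZMod ℓ).val : ℕ) : ℚ) / ℓ) := by
    have := modularSymbol_div_eq_of_intCast D.f hℓ.ne_zero ((a : ℕ) : ℤ)
    rw [Int.cast_natCast] at this
    rw [this]; push_cast; ring_nf
  unfold shiftClass primeClass
  rw [h3a, h1a, Complex.sub_im, hy, hy]
  have e3 : ((3 * a : ℕ) : ZMod ℓ) = 3 * (β : ZMod ℓ) := by rw [hβa]; push_cast; ring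
  have e1 : ((a : ℕ) : ZMod ℓ) = (β : ZMod ℓ) := hβa.symm
  rw [e3, e1]
  have : ((y (3 * (β : ZMod ℓ)) : ℝ)) - (y (β : ZMod ℓ) : ℝ) = 3 * (n : ℝ) := by
    have := congrArg (fun z : ℤ ↦ (z : ℝ)) hn
    push_cast at this
    linarith
  calc (y (3 * (β : ZMod ℓ)) : ℝ) * (minusPeriod D.f / 2) - (y (β : ZMod ℓ) : ℝ) * (minusPeriod D.f / 2)
      = (((y (3 * (β : ZMod ℓ)) : ℝ)) - (y (β : ZMod ℓ) : ℝ)) * (minusPeriod D.f / 2) := by ring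
    _ = 3 * n * (minusPeriod D.f / 2) := by rw [this]

/-- **THE POINTWISE KATO SHIFT LEVER.** At a lattice-optimal `X₀(N)`-datum `D` of a globally minimal `W` with `9 ∣ N` and `W[3]`
irreducible, the instances of F-es-18 AT THE CURVE `W` (its body with `V := W`, verbatim; all other binders universal) give
`3 ∤ c(D)` (global minimality of `W` is not used: the hypothesis is about `W`'s own Néron periods). UNCONDITIONAL: the generation input E-es-19 is the tree theorem `shiftClassGenerationThree_holds`, additivity at `3`
is `additive_of_nine_dvd_level`, the lattice-unit punchline is `functional_nonvanishing_gen`. (Route ManinLocalTwoThree's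
`katoShiftTwistManinThree_of_katoFact` is this statement with the hypothesis assumed for every curve.)
[cite: Kato2004Asterisque, Thm. 9.7 (p. 189)] [cite: KostersPannekoek2017, Thm. 1 (ii)] -/
theorem not_three_dvd_c_of_neronIntegralAt (D : ModularParametrizationData W N)
    (hKW : ∀ {N' : ℕ} [NeZero N']
      (f : CuspForm (Gamma0 N') 2) (_ : IsNewformOf W f)
      (_ : ¬ W.HasGoodReductionAtPrime 3) (_ : ¬ W.HasMultiplicativeReductionAtPrime 3)
      (_ : W.HasIrreducibleModPGaloisRep 3) (m : ℕ) [NeZero m] (_ : m.Coprime (3 * N'))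
      (χ : DirichletCharacter ℂ m) (_ : χ.IsPrimitive) (_ : χ ≠ 1) (_ : ¬ 3 ∣ orderOf χ)
      (_ : χ (3 : ZMod m) ≠ 1) (_ : χ (3 : ZMod m) ≠ -1) (ϖ : ℚ) (r : ℂ),
      (χ.Even → (ϖ : ℝ) * W.realPeriodRat = plusPeriod f →
        (∏ ℓ ∈ N'.primeFactors with ¬ ℓ ^ 2 ∣ N',
            (((ℓ : ℂ) - (W.LFunction ℓ : ℂ) * χ (ℓ : ZMod m)) *
              ((ℓ : ℂ) - (W.LFunction ℓ : ℂ) * (χ (ℓ : ZMod m))⁻¹))) *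
            twistedSymbolSum f χ = r * (plusPeriod f : ℂ) →
        ∃ s : ℕ, ¬ 3 ∣ s ∧ IsIntegral ℤ ((s : ℂ) * ϖ * r)) ∧
      (χ.Odd → (ϖ : ℝ) * W.imaginaryPeriodRat = minusPeriod f →
        (∏ ℓ ∈ N'.primeFactors with ¬ ℓ ^ 2 ∣ N',
            (((ℓ : ℂ) - (W.LFunction ℓ : ℂ) * χ (ℓ : ZMod m)) *
              ((ℓ : ℂ) - (W.LFunction ℓ : ℂ) * (χ (ℓ : ZMod m))⁻¹))) *
            twistedSymbolSum f χ = r * (minusPeriod f : ℂ) * Complex.I →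
        ∃ s : ℕ, ¬ 3 ∣ s ∧ IsIntegral ℤ ((s : ℂ) * ϖ * r)))
    (hopt : ∀ z ∈ D.L.lattice, ∃ w ∈ periodLattice D.f, z = D.c * w) (h9 : 3 ^ 2 ∣ N)
    (hirr : W.HasIrreducibleModPGaloisRep 3) : ¬ (3 : ℤ) ∣ D.c := by
  intro h3c
  obtain ⟨hg, hmu⟩ := additive_of_nine_dvd_level W D.f D.isNewformOf h9
  obtain ⟨m, hm3, hspan⟩ :=
    (shiftClassGenerationThree_iff.mp shiftClassGenerationThree_holds) W D.f 0 D.isNewformOf h9 hirr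
  have hpos : 0 < minusPeriod D.f :=
    IsNewform0.minusPeriod_pos_holds D.isNewformOf.1 D.isNewformOf.coeffField_eq_bot
  refine functional_nonvanishing_gen D.f
    {z | ∃ ℓ ∈ {ℓ | 0 ≤ ℓ ∧ AdmissiblePrime W N ℓ}, ∃ a : ℕ, 0 < a ∧ a < ℓ ∧ z = shiftClass D.f ℓ a}
    m hm3 hpos hspan ?_
  rintro t ⟨ℓ, hℓadm, a, ha1, ha2, rfl⟩
  obtain ⟨hℓ, hℓN, h12, hL⟩ := hℓadm.2
  haveI : NeZero ℓ := ⟨hℓ.ne_zero⟩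
  haveI : Fact ℓ.Prime := ⟨hℓ⟩
  obtain ⟨-, -, -, -, hℓ3, -⟩ := mod_twelve_facts (ℓ := ℓ) h12
  have hL' : ∀ q ∈ N.primeFactors, ¬ q ^ 2 ∣ N →
      jacobiSym (q : ℤ) ℓ = (if ((q : ℤ) * W.LFunction q) % 3 = 1 then -1 else 1) :=
    fun q hq hq2 ↦ by rw [hL q hq hq2]; rfl
  have hm : ℓ.Coprime (3 * N) := Nat.Coprime.mul_right
    ((Nat.coprime_primes hℓ Nat.prime_three).mpr hℓ3) ((hℓ.coprime_iff_not_dvd).mpr hℓN)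
  refine exists_int_im_shiftClass_eq_three_mul_of_oddInstances D hopt h9 h3c hℓ hℓN h12 hL' ?_ a ha1 ha2
  intro χ hχ hχ3 ϖ r hϖ hval
  exact (hKW D.f D.isNewformOf hg hmu hirr ℓ hm χ (isPrimitive_of_odd hχ) (ne_one_of_odd hχ)
    (not_three_dvd_orderOf h12 χ) hχ3 (apply_three_ne_neg_one h12 χ) ϖ r).2 hχ hϖ hval

end Lever

end Summit.BirchSwinnertonDyer.BirchSwinnertonDyer.Theorems.InertBadSignedBranchesInertBadAtThreePointwiseKatoLever

end
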